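import Summits.RiemannHypothesis.RiemannHypothesis.Theorems.Splittings.NbKappaCertificate
import HarnessLib

/-!
# NB natural visibility — `κ ≥ 1`: the compiled evaluation (SPLIT-nb-neg gen 8, §14; COMPUTATIONAL companion)

Cell rh-split, seat rh-split-nb-neg g8 (brief sha16 f79c5f09d8bcb036), card
`run/shared/lean/pub/rh-split/cards/SPLIT-nb-neg.md` §14.  Companion of the standard-axiom module
`NbKappaCertificate` (checker `checkKappa`, soundness `one_le_kappa_of_check`, hypothesis-form law
`kernel_visibility_of_one_le_kappa`): here the ONE compiled evaluation `checkKappa_holds : checkKappa = true`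
(`native_decide`: 1024 certified Euler–Maclaurin box-evaluations of `ζ` on `½ + i[k/1024,(k+1)/1024]`, tables
`mkTables 2¹¹⁰ 10 25 …`, certified lower box sum `1.163… ≥ 1`; a few seconds; proposal flag `computational`,
closure `+` one `native_decide` auxiliary axiom) and the assembled `one_le_kappa : 1 ≤ ∫₀¹ |ζ(½+it)|² dt`,
`kernel_visibility_numeric` (the `κ`-free visibility law `6250144·(2H⁵ + 32(2+5πB)/δ²) < c₁(ρ₀)² x^δ ⟹
∃ N ∈ [H, ⌊x⌋+1], bcfDistSq N > B`, closing the g7 item (γ)).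

HONEST LABEL: «SPLITTING SEARCH over kernel-typed RH-EQUIVALENCES; a splitting A ∧ B ⟹ RH is CONDITIONAL
bookkeeping unless A and B are both proved; nothing here bears on the truth of RH.»
-/

set_option linter.dupNamespace false

open Complex MeasureTheory Set
open scoped Real

namespace Summit.RiemannHypothesis.RiemannHypothesis.Theorems.Splittings.NbKappaCertificate

open Literature.NumberTheory.LFunctions (bcfDistSq)
open Literature.Barriers.RiemannHypothesis.BettinGonek2017 (residueConst)

/-- **The check passes**: 1024 certified Euler–Maclaurin box-evaluations of `ζ` on `½ + i[k/1024, (k+1)/1024]`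
with the tables `mkTables 2¹¹⁰ 10 25 …` (certified lower box sum `1.163… ≥ 1`); ONE compiled evaluation
(`native_decide`, proposal flag `computational`). [folklore] -/
theorem checkKappa_holds : checkKappa = true := by
  native_decide

/-- **`κ = ∫₀¹ |ζ(½+it)|² dt ≥ 1`** (numerically `κ = 1.2429…`; certified lower box sum `1.163…`).
[folklore] -/
theorem one_le_kappa : 1 ≤ ∫ t in (0 : ℝ)..1, ‖riemannZeta (1 / 2 + t * I)‖ ^ 2 :=
  one_le_kappa_of_check checkKappa_holds

/-- **Kernel visibility law, fully numeric in `(H, B, ρ₀)`** (SPLIT-nb-neg §14, closing the g7 item (γ)): a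
zero `ρ₀` with `Re ρ₀ ≥ ½ + δ` makes the natural NB tail conjunct `∀ N ≥ H, bcfDistSq N ≤ B` fail at some
`N ≤ ⌊x⌋ + 1` as soon as `6250144 · (2H⁵ + 32(2+5πB)/δ²) < c₁(ρ₀)² x^δ`, `x ≥ 2`.
[cite: BettinGonek2017, §2 (engine)] -/
theorem kernel_visibility_numeric {ρ₀ : ℂ} (hζ : riemannZeta ρ₀ = 0) {δ : ℝ} (hδ : 0 < δ)
    (hβ : 1 / 2 + δ ≤ ρ₀.re) (H : ℕ) {B : ℝ} (hB0 : 0 ≤ B) {x : ℝ} (hx : 2 ≤ x)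
    (hbig : 6250144 * (2 * (H : ℝ) ^ 5 + 32 * (2 + 5 * π * B) / δ ^ 2) < residueConst ρ₀ ^ 2 * x ^ δ) :
    ∃ N : ℕ, H ≤ N ∧ N ≤ ⌊x⌋₊ + 1 ∧ B < bcfDistSq N :=
  kernel_visibility_of_one_le_kappa one_le_kappa hζ hδ hβ H hB0 hx hbig

end Summit.RiemannHypothesis.RiemannHypothesis.Theorems.Splittings.NbKappaCertificate
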